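import Summits.Ventures.PercRepro.C025ProfileThinHallAll
import Summits.Ventures.PercRepro.C025ProfileThinSimplification
import Summits.Ventures.PercRepro.C025ProfileHallZero

/-!
# THE ROW `(q, q+1)` OF (Π) AND ITS HALL FORM WHEN ONLY THE SIMPLIFICATION IS THIN — and the row `(1, 2)` on every matroid (night-3 g17)
`C025ProfileThinSimplification` proved C-025 at `(q + 2, q)` under SIMPLE-THIN(q) (every rank-`q` set whose pairs are independent has
`≤ q + 1` points; loops and parallel classes of any size allowed) by a strong induction on `|E|`.  The same induction runs for the
profile row and for its Hall form, because their single-element steps are general (`profileIneq_of_isLoop` / `profileIneq_of_parallel`,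
`hallIneq_of_isLoop` / `hallIneq_of_parallel`) and the base `q = 0` is g6's `profileHall_zero` (`(H⁺_{0,v})` on every matroid):
* `hallIneq_zero`, `profileIneq_zero` — the rows `(0, v)` on every finite matroid (the row from the Hall form: `profileIneq_of_hallIneq`);
* `simpleThin_one_vacuous` — SIMPLE-THIN(1) holds for every matroid (a rank-`1` set whose pairs are independent has `≤ 1` point);
* **`profileIneq_simpleThin`** / **`hallIneq_simpleThin`**: for every `q` and every finite matroid with SIMPLE-THIN(q), the row `(q, q+1)`
  of (Π) and its Hall form — a loop doubles, a parallel pair is the profile / Hall Theorem F with the induction hypothesis on `M ＼ {y}`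
  at `q` and on `(M ／ {x}) ＼ {y}` at `q − 1`, the simple case is g16 (`profileIneq_thin_simple_all'` / `hallIneq_thin_simple_all`),
  `q = 0` is `profileHall_zero`;
* **`profileIneq_one_two`** / **`hallIneq_one_two`**: THE ROW `(1, 2)` AND ITS HALL FORM ON EVERY FINITE MATROID (SIMPLE-THIN(1) is
  vacuous) — g6's Theorem B′ (`(Π_{1,u})` on simple coloop-free matroids) at `u = 2` without any hypothesis.
No `def`, no `instance`, no notation.  Axioms: standard.
-/
open scoped Matroid
namespace PercRepro
open Set Finset ThmH Staged
namespace ThinGirth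
variable {α : Type} [DecidableEq α] {M : Matroid α} [M.Finite]

/-- The Hall form `(H⁺_{0,v})` on every finite matroid (g6's `profileHall_zero`). -/
theorem hallIneq_zero (v : ℕ) : Profile.HallIneq M 0 v :=
  fun _ h𝒜 => profileHall_zero v h𝒜

/-- The row follows from its Hall form (the family of ALL rank-`q` sets; its shadow is inside the level set). -/
theorem profileIneq_of_hallIneq {q u : ℕ} (h : Profile.HallIneq M q u) : Profile.ProfileIneq M q u := by
  unfold Profile.ProfileIneq
  refine (h (Profile.Rq M q) (Finset.Subset.refl _)).trans ?_
  exact_mod_cast Finset.card_le_card (Finset.filter_subset _ _)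

/-- The row `(0, v)` on every finite matroid. -/
theorem profileIneq_zero (v : ℕ) : Profile.ProfileIneq M 0 v :=
  profileIneq_of_hallIneq (hallIneq_zero v)

omit [DecidableEq α] in
/-- SIMPLE-THIN(1) holds for every finite matroid: a rank-`1` set whose pairs are independent has at most one point. -/
theorem simpleThin_one_vacuous :
    ∀ X ⊆ gr M, (∀ T ⊆ X, T.card ≤ 2 → rkN M T = T.card) → rkN M X = 1 → X.card ≤ 1 + 1 := by
  intro X _ hpair hX
  by_contra hc
  push Not at hc
  obtain ⟨Y, hYX, hYc⟩ := Finset.exists_subset_card_eq (show 2 ≤ X.card by omega)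
  have h1 := hpair Y hYX (by omega)
  have h2 : rkN M Y ≤ rkN M X := rkN_mono hYX
  omega

/-- **THE ROW `(q, q+1)` OF (Π) WHEN THE SIMPLIFICATION IS THIN**: for every `q` and every finite matroid in which every rank-`q` set
whose pairs are independent has at most `q + 1` points, `Profile.ProfileIneq M q (q + 1)`. -/
theorem profileIneq_simpleThin :
    ∀ (q : ℕ) (M : Matroid α) [M.Finite],
      (∀ X ⊆ gr M, (∀ T ⊆ X, T.card ≤ 2 → rkN M T = T.card) → rkN M X = q → X.card ≤ q + 1) →
      Profile.ProfileIneq M q (q + 1) := by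
  suffices H : ∀ n : ℕ, ∀ (M : Matroid α) [M.Finite], M.E.ncard = n → ∀ q : ℕ,
      (∀ X ⊆ gr M, (∀ T ⊆ X, T.card ≤ 2 → rkN M T = T.card) → rkN M X = q → X.card ≤ q + 1) →
      Profile.ProfileIneq M q (q + 1) from fun q M _ hthin => H _ M rfl q hthin
  intro n
  induction n using Nat.strong_induction_on with
  | _ n ih =>
  intro M _ hn q hthin
  have hdel : ∀ e ∈ M.E, (M ＼ {e}).E.ncard < n := by
    intro e he
    rw [Matroid.delete_ground, ← hn, ← Set.ncard_sdiff_singleton_add_one he M.ground_finite]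
    omega
  have hcondel : ∀ x ∈ M.E, ∀ y ∈ M.E, ((M ／ {x}) ＼ {y}).E.ncard < n := by
    intro x hx y _
    rw [Matroid.delete_ground, ← hn]
    have h1 : ((M ／ {x}).E \ {y}).ncard ≤ (M ／ {x}).E.ncard :=
      Set.ncard_le_ncard Set.sdiff_subset ((M ／ {x}).ground_finite)
    rw [Matroid.contract_ground, ← Set.ncard_sdiff_singleton_add_one hx M.ground_finite] at *
    omega
  rcases Nat.eq_zero_or_pos q with hq0 | hqpos
  · subst hq0
    exact profileIneq_zero 1
  -- a loop doubles
  by_cases hloop : ∃ e, M.IsLoop e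
  · obtain ⟨e, he⟩ := hloop
    exact profileIneq_of_isLoop he (ih _ (hdel e he.mem_ground) (M ＼ {e}) rfl q (simpleThin_delete hthin e))
  have hnl : ∀ x ∈ M.E, M.Indep {x} := by
    intro x hx
    exact Matroid.indep_singleton.2 ((Matroid.not_isLoop_iff hx).1 (fun h => hloop ⟨x, h⟩))
  -- simple: g16
  by_cases hsimple : ∀ T ⊆ M.E, T.encard ≤ 2 → M.Indep T
  · exact profileIneq_thin_simple_all' q hsimple (thin_of_simpleThin hsimple hthin)
  -- a parallel pair: the profile Theorem F
  obtain ⟨e, e', heE, he'E, hne, _, hpar'⟩ := exists_parallel_of_not_simple hnl hsimple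
  obtain ⟨q', rfl⟩ : ∃ q', q = q' + 1 := ⟨q - 1, by omega⟩
  refine profileIneq_of_parallel (hnl e heE) (hnl e' he'E) hne.symm hpar' q' ?_ ?_
  · exact ih _ (hdel e' he'E) (M ＼ {e'}) rfl (q' + 1) (simpleThin_delete hthin e')
  · exact ih _ (hcondel e heE e' he'E) ((M ／ {e}) ＼ {e'}) rfl q'
      (simpleThin_delete (simpleThin_contract hthin (hnl e heE)) e')

/-- **THE HALL FORM `(H⁺_{q,q+1})` WHEN THE SIMPLIFICATION IS THIN**: for every `q` and every finite matroid with SIMPLE-THIN(q),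
`Profile.HallIneq M q (q + 1)`. -/
theorem hallIneq_simpleThin :
    ∀ (q : ℕ) (M : Matroid α) [M.Finite],
      (∀ X ⊆ gr M, (∀ T ⊆ X, T.card ≤ 2 → rkN M T = T.card) → rkN M X = q → X.card ≤ q + 1) →
      Profile.HallIneq M q (q + 1) := by
  suffices H : ∀ n : ℕ, ∀ (M : Matroid α) [M.Finite], M.E.ncard = n → ∀ q : ℕ,
      (∀ X ⊆ gr M, (∀ T ⊆ X, T.card ≤ 2 → rkN M T = T.card) → rkN M X = q → X.card ≤ q + 1) →
      Profile.HallIneq M q (q + 1) from fun q M _ hthin => H _ M rfl q hthin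
  intro n
  induction n using Nat.strong_induction_on with
  | _ n ih =>
  intro M _ hn q hthin
  have hdel : ∀ e ∈ M.E, (M ＼ {e}).E.ncard < n := by
    intro e he
    rw [Matroid.delete_ground, ← hn, ← Set.ncard_sdiff_singleton_add_one he M.ground_finite]
    omega
  have hcondel : ∀ x ∈ M.E, ∀ y ∈ M.E, ((M ／ {x}) ＼ {y}).E.ncard < n := by
    intro x hx y _
    rw [Matroid.delete_ground, ← hn]
    have h1 : ((M ／ {x}).E \ {y}).ncard ≤ (M ／ {x}).E.ncard :=
      Set.ncard_le_ncard Set.sdiff_subset ((M ／ {x}).ground_finite)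
    rw [Matroid.contract_ground, ← Set.ncard_sdiff_singleton_add_one hx M.ground_finite] at *
    omega
  rcases Nat.eq_zero_or_pos q with hq0 | hqpos
  · subst hq0
    exact hallIneq_zero 1
  by_cases hloop : ∃ e, M.IsLoop e
  · obtain ⟨e, he⟩ := hloop
    exact hallIneq_of_isLoop he (ih _ (hdel e he.mem_ground) (M ＼ {e}) rfl q (simpleThin_delete hthin e))
  have hnl : ∀ x ∈ M.E, M.Indep {x} := by
    intro x hx
    exact Matroid.indep_singleton.2 ((Matroid.not_isLoop_iff hx).1 (fun h => hloop ⟨x, h⟩))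
  by_cases hsimple : ∀ T ⊆ M.E, T.encard ≤ 2 → M.Indep T
  · exact hallIneq_thin_simple_all q hsimple (thin_of_simpleThin hsimple hthin)
  obtain ⟨e, e', heE, he'E, hne, _, hpar'⟩ := exists_parallel_of_not_simple hnl hsimple
  obtain ⟨q', rfl⟩ : ∃ q', q = q' + 1 := ⟨q - 1, by omega⟩
  refine hallIneq_of_parallel (hnl e heE) (hnl e' he'E) hne.symm hpar' q' ?_ ?_
  · exact ih _ (hdel e' he'E) (M ＼ {e'}) rfl (q' + 1) (simpleThin_delete hthin e')
  · exact ih _ (hcondel e heE e' he'E) ((M ／ {e}) ＼ {e'}) rfl q'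
      (simpleThin_delete (simpleThin_contract hthin (hnl e heE)) e')

/-- The row `(q, q+1)` and its Hall form when the simplification is thin, for one matroid. -/
theorem profileIneq_and_hallIneq_simpleThin (q : ℕ)
    (hthin : ∀ X ⊆ gr M, (∀ T ⊆ X, T.card ≤ 2 → rkN M T = T.card) → rkN M X = q → X.card ≤ q + 1) :
    Profile.ProfileIneq M q (q + 1) ∧ Profile.HallIneq M q (q + 1) :=
  ⟨profileIneq_simpleThin q M hthin, hallIneq_simpleThin q M hthin⟩

/-- **THE ROW `(1, 2)` OF (Π) ON EVERY FINITE MATROID**: `Σ_{B : ρ(B) = 1, ρ(E ∖ B) ≥ 2} C(ρ(E∖B)+1, 2)/C(ρ(E∖B)+1, 1) ≤ #{S : ρ(S) = 2}`. -/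
theorem profileIneq_one_two : Profile.ProfileIneq M 1 2 :=
  profileIneq_simpleThin 1 M simpleThin_one_vacuous

/-- **THE HALL FORM `(H⁺_{1,2})` ON EVERY FINITE MATROID**. -/
theorem hallIneq_one_two : Profile.HallIneq M 1 2 :=
  hallIneq_simpleThin 1 M simpleThin_one_vacuous

end ThinGirth
end PercRepro
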